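import Mathlib
import HarnessLib
import Summits.NavierStokesRegularity.NavierStokesRegularity.Theorems.UnthreadedRigidityDoorUnthreadedRigidityVirialHornDefs
import Summits.NavierStokesRegularity.NavierStokesRegularity.Theorems.UnthreadedRigidityDoorUnthreadedRigidityThreadingJetsWindowGeneric

/-!
# Route `UnthreadedRigidityDoor`, wall item W2 `UnthreadedRigidity` (stmt-NavierStokesRegularity-27585) — LINE g12-2 «PERSISTENCE FILTER»
# (ns-idea-6 g12, `Persistence_sketch.lean` 09bc8f71301208c4; idea-crit-7 g8 PASS; DIRECTOR-NS #294): support S «AMPLITUDE VANISHING»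
# `AmplitudeVanishing`, VERBATIM

Seat ns-es-p1 g8 (W2 second queue; announce-before-propose on the ideators bus).

* `strainAmpL_eq_zero_imp` — if the strain amplitude `α_l[H] = rH′ + (l+1)H` of a virial-admissible profile vanishes on `(0,∞)`, then `H ≡ 0` there:
  `(r^{l+1}H)′ = r^l α = 0`, so `r^{l+1}H ≡ d`; `H(r) = h(r²)` is bounded near `0⁺` while `r^{l+1} → 0`, whence `d = 0`.
* `amplitudeVanishing` — **`AmplitudeVanishing` VERBATIM**: an admissible profile, real-analytic on `(0,∞)`, with `K_l[H]·α_l[H] ≡ 0` there, vanishes on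
  `(0,∞)`.  PROOF (CARD §3.4): `K` (`…ThreadingJets.analyticOnNhd_vortAmpL`) and `α` are analytic on the connected set `(0,∞)`; if `α(r₀) ≠ 0` then `K = 0`
  near `r₀`, hence `K ≡ 0` (identity theorem) and `H ≡ 0` by the tree's `…ThreadingJets.eq_zero_of_vortAmpL_eq_zero`; otherwise `α ≡ 0` and the first
  lemma applies.

HONEST LABEL: an elementary ODE support of a files-only rung line; nothing here bears on `UnthreadedRigidity` (27585), the door Target, W2 or Navier–Stokes
regularity; no summit statement is proved.  MODEL/rung work.
-/

noncomputable section

-- the summit and its single sub-problem share the name (CONVENTIONS §1), as in every Theorems file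
set_option linter.dupNamespace false

namespace Summit.NavierStokesRegularity.NavierStokesRegularity.Theorems.UnthreadedRigidity.Persistence

open Set Function Filter Topology
open Summit.NavierStokesRegularity.NavierStokesRegularity.Theorems.UnthreadedRigidity.VirialHorn (VirialAdmissible vortAmpL strainAmpL)
open Summit.NavierStokesRegularity.NavierStokesRegularity.Theorems.UnthreadedRigidity.ThreadingJets
  (virialAdmissible_hasDerivAt_of_pos eq_zero_of_vortAmpL_eq_zero analyticOnNhd_vortAmpL)

/-! ## `α ≡ 0` forces a null profile -/

/-- **A virial-admissible profile with identically vanishing strain amplitude on `(0,∞)` is null there**: `(r^{l+1}H)′ = r^l α_l[H] = 0`, so `r^{l+1}H`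
is constant on `(0,∞)`, and the constant is `0` because `H(r) = h(r²)` stays bounded as `r → 0⁺`. -/
theorem strainAmpL_eq_zero_imp {l : ℕ} {H : ℝ → ℝ} (hH : VirialAdmissible l H)
    (hα : ∀ r : ℝ, 0 < r → strainAmpL l H r = 0) : ∀ r : ℝ, 0 < r → H r = 0 := by
  obtain ⟨h, hh, hHh, hder⟩ := virialAdmissible_hasDerivAt_of_pos hH
  -- `G = r^{l+1} H` has zero derivative on `(0,∞)`
  set G : ℝ → ℝ := fun r => r ^ (l + 1) * H r with hG_def
  have hGd : ∀ r, 0 < r → HasDerivAt G (((l + 1 : ℕ) : ℝ) * r ^ l * H r + r ^ (l + 1) * deriv H r) r := fun r hr => by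
    have h1 : HasDerivAt (fun s : ℝ => s ^ (l + 1)) (((l + 1 : ℕ) : ℝ) * r ^ l) r := by
      simpa using hasDerivAt_pow (l + 1) r
    exact h1.mul (hder r hr).differentiableAt.hasDerivAt
  have hG0 : ∀ r, 0 < r → deriv G r = 0 := fun r hr => by
    rw [(hGd r hr).deriv]
    have hαr := hα r hr
    unfold strainAmpL at hαr
    have e : ((l + 1 : ℕ) : ℝ) * r ^ l * H r + r ^ (l + 1) * deriv H r = r ^ l * (r * deriv H r + ((l : ℝ) + 1) * H r) := by
      push_cast; ring
    rw [e, hαr, mul_zero]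
  have hGdiff : DifferentiableOn ℝ G (Ioi 0) := fun r hr => (hGd r hr).differentiableAt.differentiableWithinAt
  have hGconst : ∀ r ∈ Ioi (0 : ℝ), ∀ s ∈ Ioi (0 : ℝ), G r = G s :=
    fun r hr s hs => isOpen_Ioi.is_const_of_deriv_eq_zero (convex_Ioi 0).isPreconnected hGdiff
      (fun x hx => hG0 x hx) hr hs
  -- the constant is `0`: `G(s) = s^{l+1} h(s²) → 0 · h(0) = 0` as `s → 0⁺`
  set g : ℝ → ℝ := fun r => r ^ (l + 1) * h (r ^ 2) with hg_def
  have hgc : Continuous g := (continuous_id.pow _).mul (hh.continuous.comp (continuous_id.pow 2))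
  have hg0 : g 0 = 0 := by simp [hg_def]
  have hGg : ∀ r, 0 < r → G r = g r := fun r hr => by
    simp only [hG_def, hg_def, hHh r hr.le]
  have hGzero : ∀ r, 0 < r → G r = 0 := by
    intro r hr
    have hlim : Tendsto g (𝓝[>] (0 : ℝ)) (𝓝 (g 0)) := hgc.continuousAt.tendsto.mono_left nhdsWithin_le_nhds
    have hlim' : Tendsto (fun _ : ℝ => G r) (𝓝[>] (0 : ℝ)) (𝓝 (g 0)) := by
      refine hlim.congr' ?_
      filter_upwards [self_mem_nhdsWithin] with s hs
      rw [← hGg s hs, hGconst s hs r hr]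
    rw [hg0] at hlim'
    exact tendsto_nhds_unique tendsto_const_nhds hlim'
  intro r hr
  have h1 := hGzero r hr
  simp only [hG_def] at h1
  rcases mul_eq_zero.1 h1 with h2 | h2
  · exact absurd h2 (pow_ne_zero _ hr.ne')
  · exact h2

/-! ## The stub -/

/-- **`AmplitudeVanishing` (VERBATIM)**: an admissible profile, real-analytic on `(0,∞)`, with `K_l[H]·α_l[H] ≡ 0` there, vanishes on `(0,∞)`
(module docstring for the proof). -/
theorem amplitudeVanishing :
    ∀ (l : ℕ) (H : ℝ → ℝ), 1 ≤ l → VirialAdmissible l H → AnalyticOnNhd ℝ H (Set.Ioi 0) →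
      (∀ r : ℝ, 0 < r → vortAmpL l H r * strainAmpL l H r = 0) → ∀ r : ℝ, 0 < r → H r = 0 := by
  intro l H _ hH hHa hKα
  by_cases hαz : ∀ r : ℝ, 0 < r → strainAmpL l H r = 0
  · exact strainAmpL_eq_zero_imp hH hαz
  · -- some `α(r₀) ≠ 0`: then `K = 0` near `r₀`, hence everywhere on `(0,∞)` by analyticity
    push Not at hαz
    obtain ⟨r₀, hr₀, hα0⟩ := hαz
    have hK : AnalyticOnNhd ℝ (vortAmpL l H) (Ioi 0) := analyticOnNhd_vortAmpL hHa
    -- `α` is continuous at `r₀`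
    have hαa : AnalyticAt ℝ (strainAmpL l H) r₀ := by
      have h1 : AnalyticAt ℝ (deriv H) r₀ := hHa.deriv r₀ hr₀
      show AnalyticAt ℝ (fun r => r * deriv H r + ((l : ℝ) + 1) * H r) r₀
      exact (analyticAt_id.mul h1).add (analyticAt_const.mul (hHa r₀ hr₀))
    have hne : ∀ᶠ r in 𝓝 r₀, strainAmpL l H r ≠ 0 := hαa.continuousAt.eventually_ne hα0
    have hKev : vortAmpL l H =ᶠ[𝓝 r₀] 0 := by
      filter_upwards [hne, Ioi_mem_nhds hr₀] with r hr hr0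
      have h := hKα r hr0
      rcases mul_eq_zero.1 h with h1 | h1
      · exact h1
      · exact absurd h1 hr
    have hK0 := hK.eqOn_zero_of_preconnected_of_eventuallyEq_zero (convex_Ioi (0 : ℝ)).isPreconnected hr₀ hKev
    exact fun r hr => (eq_zero_of_vortAmpL_eq_zero hH (fun s hs => hK0 hs) r hr).1

end Summit.NavierStokesRegularity.NavierStokesRegularity.Theorems.UnthreadedRigidity.Persistence

end
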